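import Summits.QuantumFields.BalabanUV.T4Continuum.Support.ActivityTermModel

/-!
# NE5 ∕ U3, route P2 — the MAJORANT BUDGET of the term model: the per-term amplitudes ARE (explicit factor)·(2e^{β̄})·size,
# so the junction's domination `Σ_i G_i ≤ m` reduces to the one-run sum of term MODULI with the moduli `Λop, Λhist` chosen as
# the amplitude ratios (skeleton `t4/skeletons/NE5-t4-ne5-p2.md` §3 leaf L03, the `hsum` binder; §6)

Cell `pub-balaban`, unit `b2b-balaban-t4-ne5-p2-g17` (T⁴ fan-out NE5 ∕ node U3, PROVER seat P2 «polymer-activity Lipschitz route»).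
Summits-side new work under the LEAN PLACEMENT RULE (cell bookkeeping; NOT a Literature module).  HONEST FRAMING: rung (B)+1 of the
FINITE-VOLUME T⁴ continuum programme — NOT infinite volume, NOT a mass gap, NOT the Clay problem, NOT a proof of NE5 (NOT PRINTED in
[Balaban1987RG1]–[Balaban1989LargeFieldII]; they print ε-UNIFORM bounds, never η-RATES).  HONEST DEPENDENCY (cell line, verbatim):
continuum YM on T⁴ ⇐ BetaPertH ∧ nine spine estimates (0/9 proved); BetaPertH ⇐ (D1) ∧ (D4) ∧ CAP+tail; G-an2-4 gates asym, D1 and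
NE2/3/4.

WHAT THIS FILE DOES.  Every END face of the activity route over the term model (`ActivityStepJunction`, `ActivityRouteEnd`,
`InsertionLinearRate`, `ClusterRepDecay`) carries the binder
  `hsum : Σ_{i ∈ terms} 𝔉.G Λop Λhist ρ₀ g U X γ i ≤ m g U γ`,   `G = size + ampOp∕Λop + ampHist∕Λhist`,
and L03 asks the (2.38)-shaped Kotecký–Preiss budget of THAT majorant `m`.  What [Balaban1988RG2Cluster] bounds for one run is the SUM
OF THE MODULI of the (2.14)-terms of `H(Z)` ((2.15) p. 15 through (2.20) p. 16 – (2.37) p. 20, summarised as Lemma 3 (2.38) p. 20) —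
i.e. `Σ_i size_i`, printed KIND.  This file closes the bookkeeping between the two, with NO estimate:
* `ampOp_eq` ∕ `ampHist_eq`: the amplitudes of `ActivityTermDatum` ARE `opFactor·(2e^{β̄})·size` and `histFactor·(2e^{β̄})·size` with
  EXPLICIT one-run factors (`opFactor` = the bracket of read-out moduli κ• and Gaussian constants of `ampOp`, `histFactor` =
  `n₀K·(2 + 4κP K M₀′∕(e u₀ ζ))`, `β̄ = βbar ρ₀`) — definitional unfolding;
* `G_le_of_ratios`: if the moduli dominate the amplitude ratios — `opFactor·2e^{β̄} ≤ Λop`, `histFactor·2e^{β̄} ≤ Λhist` (Λ's > 0) — then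
  `G ≤ 3·size` for that term;
* `hsum_of_sizes`: hence, with such UNIFORM ratio bounds over the terms, `Σ_i G_i ≤ 3·Σ_i size_i`, and `hsum` follows from the
  one-run term-moduli budget `3·Σ_i size_i ≤ m` — so L03's `m` is THREE TIMES the printed (2.38)-type majorant of the term moduli (one
  more factor of the printed kind «ε₁ sufficiently small»), and the history modulus `Λhist` that enters the threshold `r_fb` is the
  uniform history-amplitude ratio (cf. `T4ActivityThreshold.threshold_le_of_pins`: Λhist ≤ 24K″∕(eσ)).
Nothing of the manuscripts under audit is asserted (cited for KIND∕locus only).  0 sorry; no new axioms.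
-/

open scoped BigOperators

namespace Summit.QuantumFields.BalabanUV.T4Continuum.ActivityTermBudget

open Summit.QuantumFields.BalabanUV.T4Continuum.ActivityTermModel (TermDatum TermConsts TermFamily)
open Literature.MathematicalPhysics.QuantumFieldTheory.Balaban1983to89.T4OutputRate (Carriers)
open Literature.MathematicalPhysics.QuantumFieldTheory.Balaban1983to89.T4ActivityLipschitz (ClusterRep)

section PerTerm

variable {Op Hist ι κ S Ω Ω₀ 𝒴 𝒞 : Type*} [MeasurableSpace Ω] [MeasurableSpace Ω₀]
  (𝔱 : TermDatum Op Hist ι κ S Ω Ω₀ 𝒴 𝒞) (𝔠 : TermConsts)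

/-- [folklore] The one-run OPERATOR-amplitude factor of a term (the bracket of `TermDatum.ampOp` in front of `2e^{β̄}·M′∕ζ`). -/
noncomputable def opFactor : ℝ :=
  (𝔠.cG + 𝔠.κQ * 𝔠.W * 𝔠.Kk + Real.exp 1 * 𝔠.u * (𝔠.κR * 𝔱.n₀K 𝔠))
      * (2 + 4 * (𝔠.κP * 𝔠.K) * 𝔠.M₀' / (Real.exp 1 * 𝔠.u₀ * 𝔠.ζ)) / (Real.exp 1 * 𝔠.u)
    + 4 * (𝔠.κP * 𝔠.K) * 𝔠.M₀' / (Real.exp 1 * 𝔠.u₀ * 𝔠.ζ)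

/-- [folklore] The one-run HISTORY-amplitude factor of a term (the bracket of `TermDatum.ampHist`). -/
noncomputable def histFactor : ℝ := 𝔱.n₀K 𝔠 * (2 + 4 * (𝔠.κP * 𝔠.K) * 𝔠.M₀' / (Real.exp 1 * 𝔠.u₀ * 𝔠.ζ))

/-- [folklore] **The operator amplitude IS `opFactor·2e^{β̄}·size`** (definitional). -/
theorem ampOp_eq (ρ₀ : ℝ) : 𝔱.ampOp 𝔠 ρ₀ = opFactor 𝔱 𝔠 * (2 * Real.exp (𝔱.βbar 𝔠 ρ₀)) * 𝔠.size := by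
  unfold TermDatum.ampOp opFactor TermConsts.size
  ring

/-- [folklore] **The history amplitude IS `histFactor·2e^{β̄}·size`** (definitional). -/
theorem ampHist_eq (ρ₀ : ℝ) : 𝔱.ampHist 𝔠 ρ₀ = histFactor 𝔱 𝔠 * (2 * Real.exp (𝔱.βbar 𝔠 ρ₀)) * 𝔠.size := by
  unfold TermDatum.ampHist histFactor TermConsts.size
  ring

/-- [folklore] **Amplitude-ratio bounds make the per-term majorant three sizes**: if `opFactor·2e^{β̄} ≤ Λop` and
`histFactor·2e^{β̄} ≤ Λhist` with `Λop, Λhist > 0` and `size ≥ 0`, then `size + ampOp∕Λop + ampHist∕Λhist ≤ 3·size`. -/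
theorem G_le_of_ratios {ρ₀ Λop Λhist : ℝ} (hΛop : 0 < Λop) (hΛhist : 0 < Λhist) (hsize : 0 ≤ 𝔠.size)
    (hop : opFactor 𝔱 𝔠 * (2 * Real.exp (𝔱.βbar 𝔠 ρ₀)) ≤ Λop)
    (hhist : histFactor 𝔱 𝔠 * (2 * Real.exp (𝔱.βbar 𝔠 ρ₀)) ≤ Λhist) :
    𝔠.size + 𝔱.ampOp 𝔠 ρ₀ / Λop + 𝔱.ampHist 𝔠 ρ₀ / Λhist ≤ 3 * 𝔠.size := by
  rw [ampOp_eq, ampHist_eq]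
  have h1 : opFactor 𝔱 𝔠 * (2 * Real.exp (𝔱.βbar 𝔠 ρ₀)) * 𝔠.size / Λop ≤ 𝔠.size := by
    rw [div_le_iff₀ hΛop]
    calc opFactor 𝔱 𝔠 * (2 * Real.exp (𝔱.βbar 𝔠 ρ₀)) * 𝔠.size ≤ Λop * 𝔠.size :=
          mul_le_mul_of_nonneg_right hop hsize
      _ = 𝔠.size * Λop := mul_comm _ _
  have h2 : histFactor 𝔱 𝔠 * (2 * Real.exp (𝔱.βbar 𝔠 ρ₀)) * 𝔠.size / Λhist ≤ 𝔠.size := by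
    rw [div_le_iff₀ hΛhist]
    calc histFactor 𝔱 𝔠 * (2 * Real.exp (𝔱.βbar 𝔠 ρ₀)) * 𝔠.size ≤ Λhist * 𝔠.size :=
          mul_le_mul_of_nonneg_right hhist hsize
      _ = 𝔠.size * Λhist := mul_comm _ _
  linarith

end PerTerm

section Family

variable {C : Carriers} {R : ClusterRep C} {Op Hist : Type*}
variable {ι κ S Ω Ω₀ 𝒴 𝒞 : Type*} [Fintype ι] [Fintype κ] [MeasurableSpace Ω] [MeasurableSpace Ω₀] {J : Type*}
  (𝔉 : TermFamily R Op Hist ι κ S Ω Ω₀ 𝒴 𝒞 J)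

/-- [folklore] **THE `hsum` BINDER FROM THE ONE-RUN TERM-MODULI BUDGET.**  If on the window every term has nonnegative size and
amplitude ratios under the moduli (`opFactor·2e^{β̄} ≤ Λop`, `histFactor·2e^{β̄} ≤ Λhist`), and the SUM OF THE TERM SIZES of each
polymer is under a third of the majorant, `3·Σ_i size_i ≤ m g U γ` (the printed KIND: the (2.20)–(2.37) ⟹ (2.38) bound of the sum of
the term moduli of H(Z), [Balaban1988RG2Cluster] pp. 16–20), then `Σ_i G_i ≤ m g U γ`. -/
theorem hsum_of_sizes {W : Set (ℕ → ℝ)} {m : (ℕ → ℝ) → C.BgB → R.P → ℝ} {Λop Λhist ρ₀ : ℝ}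
    (hΛop : 0 < Λop) (hΛhist : 0 < Λhist)
    (hsize : ∀ g ∈ W, ∀ (U : C.BgB) (X : C.Dom), ∀ γ ∈ R.vol X, ∀ i ∈ 𝔉.terms g U X γ, 0 ≤ (𝔉.𝔠 g U X γ i).size)
    (hop : ∀ g ∈ W, ∀ (U : C.BgB) (X : C.Dom), ∀ γ ∈ R.vol X, ∀ i ∈ 𝔉.terms g U X γ,
      opFactor (𝔉.𝔱 g U X γ i) (𝔉.𝔠 g U X γ i) * (2 * Real.exp ((𝔉.𝔱 g U X γ i).βbar (𝔉.𝔠 g U X γ i) ρ₀)) ≤ Λop)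
    (hhist : ∀ g ∈ W, ∀ (U : C.BgB) (X : C.Dom), ∀ γ ∈ R.vol X, ∀ i ∈ 𝔉.terms g U X γ,
      histFactor (𝔉.𝔱 g U X γ i) (𝔉.𝔠 g U X γ i) * (2 * Real.exp ((𝔉.𝔱 g U X γ i).βbar (𝔉.𝔠 g U X γ i) ρ₀)) ≤ Λhist)
    (hbudget : ∀ g ∈ W, ∀ (U : C.BgB) (X : C.Dom), ∀ γ ∈ R.vol X,
      3 * ∑ i ∈ 𝔉.terms g U X γ, (𝔉.𝔠 g U X γ i).size ≤ m g U γ) :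
    ∀ g ∈ W, ∀ (U : C.BgB) (X : C.Dom), ∀ γ ∈ R.vol X, ∑ i ∈ 𝔉.terms g U X γ, 𝔉.G Λop Λhist ρ₀ g U X γ i ≤ m g U γ := by
  intro g hg U X γ hγ
  calc ∑ i ∈ 𝔉.terms g U X γ, 𝔉.G Λop Λhist ρ₀ g U X γ i
      ≤ ∑ i ∈ 𝔉.terms g U X γ, 3 * (𝔉.𝔠 g U X γ i).size :=
        Finset.sum_le_sum fun i hi =>
          G_le_of_ratios _ _ hΛop hΛhist (hsize g hg U X γ hγ i hi) (hop g hg U X γ hγ i hi) (hhist g hg U X γ hγ i hi)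
    _ = 3 * ∑ i ∈ 𝔉.terms g U X γ, (𝔉.𝔠 g U X γ i).size := by rw [Finset.mul_sum]
    _ ≤ m g U γ := hbudget g hg U X γ hγ

end Family

end Summit.QuantumFields.BalabanUV.T4Continuum.ActivityTermBudget
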